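import Literature.Analysis.Complex.SimplyConnectedOfCompl
import Literature.Topology.PlaneTopology.EilenbergCriterion
import HarnessLib

/-!
# The complement of a Jordan arc, inverted about an endpoint, and its Riemann map

For a Jordan arc `L ⊆ ℂ` (`e : [0, 1] ≃ₜ L`) with initial point `a = e 0`, the inversion
`T(w) = (w - a)⁻¹` carries the connected open set `ℂ ∖ L` (separation theorem for Jordan arcs,
`Literature.Topology.PlaneTopology.JordanArcSeparation_holds`) onto the punctured set
`Ω' ∖ {0}`, where

  `Ω' = arcInv L a = {0} ∪ {ζ ≠ 0 : a + ζ⁻¹ ∉ L}`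

is OPEN (it contains the disc `B(0, R⁻¹)` when `L ⊆ B̄(a, R)`), CONNECTED, and HOLE-FREE: its
complement `T(L ∖ {a})` is connected (the arc minus an endpoint is the continuous injective
image of `(0, 1]`) and unbounded (it explodes at `a`). Hence `Ω'` carries holomorphic square
roots (`Complex.hasSqrt_of_compl`) and the Riemann mapping theorem of the tree
(`Complex.exists_bijOn_ball_of_hasSqrt`) gives a conformal map `φ : Ω' → 𝔻` with `φ(0) = 0`
(`exists_arcRiemannMap`). The pull-back

  `arcGreen e w = -log ‖φ((w - a)⁻¹)‖` (`w ∉ L`), `= 0` (`w ∈ L`)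

is **the Green function of `ℂ ∖ L` with pole at `∞`**: positive and harmonic off `L` (it is
`-log ‖Φ‖` for the zero-free holomorphic `Φ = φ ∘ T`, `‖Φ‖ < 1`), and continuous on `ℂ` with
value `0` on `L` (`continuous_arcGreen`: the sets `{‖φ‖ ≤ 1 - ε}` are the compact images of
closed discs under `φ⁻¹`). Quantitative bounds (Koebe, Schwarz, Harnack) are drawn in
`ArcGreenEstimates`; the Green function is the potential-theoretic input of the harmonic-measure
estimate behind [LSW] Lemma 6.3 (`Literature/Probability/RandomPlanarGeometry`).

References: Ch. Pommerenke, *Boundary Behaviour of Conformal Maps* (1992), §1.1–1.3 (conformal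
maps of simply connected domains, Koebe); T. Ransford, *Potential Theory in the Complex Plane*
(1995), §4.4 (Green functions) — only the construction via the Riemann map is used here.
-/

noncomputable section

open Set Filter Metric Topology Function
open Literature.Topology.PlaneTopology (JordanArcSeparation_holds isCompact_of_homeomorph_unitInterval)
open scoped unitInterval

namespace Literature.Analysis.Complex

/-! ### Jordan arcs: endpoints, the arc minus an endpoint -/

section Arc

variable {L : Set ℂ} (e : I ≃ₜ L)

/-- A Jordan arc is compact. [folklore] -/
theorem isCompact_arc (e : I ≃ₜ L) : IsCompact L := isCompact_of_homeomorph_unitInterval e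

/-- The endpoints of a Jordan arc are distinct. [folklore] -/
theorem arc_endpoints_ne : ((e 0 : L) : ℂ) ≠ ((e 1 : L) : ℂ) := fun h ↦ by
  have : (0 : I) = 1 := e.injective (Subtype.ext h)
  exact zero_ne_one this

/-- The arc minus its initial point is the image of `(0, 1]`, hence connected. [folklore] -/
theorem isConnected_arc_diff_endpoint : IsConnected (L \ {((e 0 : L) : ℂ)}) := by
  have heq : L \ {((e 0 : L) : ℂ)} = (fun s : I ↦ ((e s : L) : ℂ)) '' Ioc (0 : I) 1 := by
    ext w
    constructor
    · rintro ⟨hw, hw0⟩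
      refine ⟨e.symm ⟨w, hw⟩, ⟨?_, unitInterval.le_one _⟩, by simp⟩
      rw [lt_iff_le_and_ne]
      refine ⟨unitInterval.nonneg _, fun h ↦ hw0 ?_⟩
      rw [mem_singleton_iff, h]
      simp
    · rintro ⟨s, hs, rfl⟩
      refine ⟨(e s).2, fun h ↦ ?_⟩
      rw [mem_singleton_iff] at h
      have : s = 0 := e.injective (Subtype.ext h)
      rw [this] at hs
      exact lt_irrefl _ hs.1
  rw [heq]
  refine (isConnected_Ioc zero_lt_one).image _ ?_
  exact (continuous_subtype_val.comp e.continuous).continuousOn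

/-- The final point lies in the arc minus its initial point. [folklore] -/
theorem endpoint_one_mem_diff : ((e 1 : L) : ℂ) ∈ L \ {((e 0 : L) : ℂ)} :=
  ⟨(e 1).2, fun h ↦ arc_endpoints_ne e (mem_singleton_iff.1 h).symm⟩

/-- The initial point is a limit of the other points of the arc. [folklore] -/
theorem endpoint_mem_closure_diff : ((e 0 : L) : ℂ) ∈ closure (L \ {((e 0 : L) : ℂ)}) := by
  have hcont : Continuous fun s : I ↦ ((e s : L) : ℂ) := continuous_subtype_val.comp e.continuous
  have h0 : (0 : I) ∈ closure (Ioc (0 : I) 1) := by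
    rw [closure_Ioc zero_ne_one]
    exact ⟨le_rfl, zero_le_one⟩
  have := map_mem_closure hcont h0 (t := L \ {((e 0 : L) : ℂ)}) fun s hs ↦
    ⟨(e s).2, fun h ↦ by
      have : s = 0 := e.injective (Subtype.ext (mem_singleton_iff.1 h))
      rw [this] at hs; exact lt_irrefl _ hs.1⟩
  simpa using this

end Arc

/-! ### The inverted complement -/

/-- **The complement of `L`, inverted about `a`, with the origin added**:
`arcInv L a = {0} ∪ {ζ ≠ 0 : a + ζ⁻¹ ∉ L}` — the image of `(ℂ ∖ L) ∪ {∞}` under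
`w ↦ (w - a)⁻¹`. [folklore] -/
def arcInv (L : Set ℂ) (a : ℂ) : Set ℂ :=
  {ζ : ℂ | ζ = 0 ∨ (ζ ≠ 0 ∧ a + ζ⁻¹ ∉ L)}

section Inversion

variable {L : Set ℂ} {a : ℂ}

/-- The origin belongs to `arcInv L a`. [folklore] -/
theorem zero_mem_arcInv : (0 : ℂ) ∈ arcInv L a := Or.inl rfl

/-- Membership of a nonzero point. [folklore] -/
theorem mem_arcInv_of_ne_zero {ζ : ℂ} (hζ : ζ ≠ 0) : ζ ∈ arcInv L a ↔ a + ζ⁻¹ ∉ L := by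
  simp [arcInv, hζ]

/-- The inversion of a point off `L` lies in `arcInv L a`. [folklore] -/
theorem inv_sub_mem_arcInv (ha : a ∈ L) {w : ℂ} (hw : w ∉ L) : (w - a)⁻¹ ∈ arcInv L a := by
  have hwa : w - a ≠ 0 := sub_ne_zero.2 fun h ↦ hw (h ▸ ha)
  rw [mem_arcInv_of_ne_zero (inv_ne_zero hwa), inv_inv, add_sub_cancel]
  exact hw

/-- The complement of `arcInv L a` is the inverted punctured arc `{(x - a)⁻¹ : x ∈ L ∖ {a}}`. [folklore] -/
theorem compl_arcInv_eq (L : Set ℂ) (a : ℂ) : (arcInv L a)ᶜ = (fun x ↦ (x - a)⁻¹) '' (L \ {a}) := by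
  ext ζ
  simp only [arcInv, mem_compl_iff, mem_setOf_eq, not_or, not_and, not_not, mem_image,
    Set.mem_sdiff, mem_singleton_iff]
  constructor
  · rintro ⟨hζ, h⟩
    refine ⟨a + ζ⁻¹, ⟨h hζ, fun h' ↦ ?_⟩, by simp⟩
    have : ζ⁻¹ = 0 := by simpa using h'
    exact hζ (inv_eq_zero.1 this)
  · rintro ⟨x, ⟨hx, hxa⟩, rfl⟩
    have hxa' : x - a ≠ 0 := sub_ne_zero.2 hxa
    exact ⟨inv_ne_zero hxa', fun _ ↦ by rwa [inv_inv, add_sub_cancel]⟩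

/-- A small disc about the origin lies in `arcInv L a` when `L ⊆ B̄(a, R)`. [folklore] -/
theorem ball_subset_arcInv {R : ℝ} (hR : 0 < R) (hL : L ⊆ closedBall a R) : ball (0 : ℂ) R⁻¹ ⊆ arcInv L a := by
  intro ζ hζ
  rcases eq_or_ne ζ 0 with rfl | hζ0
  · exact zero_mem_arcInv
  rw [mem_arcInv_of_ne_zero hζ0]
  intro hmem
  have h1 := hL hmem
  rw [mem_closedBall, dist_eq_norm, add_sub_cancel_left, norm_inv] at h1
  rw [mem_ball_zero_iff] at hζ
  have h2 : R < ‖ζ‖⁻¹ := by rwa [lt_inv_comm₀ hR (norm_pos_iff.2 hζ0)]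
  linarith

/-- `arcInv L a` is open, for `L` compact. [folklore] -/
theorem isOpen_arcInv (hL : IsCompact L) : IsOpen (arcInv L a) := by
  obtain ⟨R, hR0, hR⟩ := hL.isBounded.subset_closedBall_lt 0 a
  rw [isOpen_iff_mem_nhds]
  intro ζ hζ
  rcases eq_or_ne ζ 0 with rfl | hζ0
  · exact mem_of_superset (ball_mem_nhds 0 (inv_pos.2 hR0)) (ball_subset_arcInv hR0 hR)
  · have hmem : a + ζ⁻¹ ∉ L := (mem_arcInv_of_ne_zero hζ0).1 hζ
    have hcont : ContinuousAt (fun ξ : ℂ ↦ a + ξ⁻¹) ζ := (continuousAt_inv₀ hζ0).const_add a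
    have h1 : ∀ᶠ ξ in 𝓝 ζ, a + ξ⁻¹ ∉ L :=
      hcont.preimage_mem_nhds (hL.isClosed.isOpen_compl.mem_nhds hmem)
    have h2 : ∀ᶠ ξ in 𝓝 ζ, ξ ≠ 0 := isOpen_ne.mem_nhds hζ0
    filter_upwards [h1, h2] with ξ h1 h2
    exact (mem_arcInv_of_ne_zero h2).2 h1

variable (e : I ≃ₜ L)

/-- For a Jordan arc inverted about its initial point, the complement of `arcInv` is connected. [folklore] -/
theorem isConnected_compl_arcInv :
    IsConnected (arcInv L ((e 0 : L) : ℂ))ᶜ := by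
  rw [compl_arcInv_eq]
  refine (isConnected_arc_diff_endpoint e).image _ fun x hx ↦ ?_
  exact ((by fun_prop : ContinuousAt (fun x : ℂ ↦ x - ((e 0 : L) : ℂ)) x).inv₀
    (sub_ne_zero.2 hx.2)).continuousWithinAt

/-- … and unbounded (it explodes at the initial point). [folklore] -/
theorem not_isBounded_compl_arcInv :
    ¬ Bornology.IsBounded (arcInv L ((e 0 : L) : ℂ))ᶜ := by
  intro hb
  rw [compl_arcInv_eq] at hb
  obtain ⟨M, hM⟩ := hb.subset_closedBall 0
  set a : ℂ := ((e 0 : L) : ℂ)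
  -- points of `L ∖ {a}` stay `(|M|+1)⁻¹`-away from `a`, contradicting `a ∈ closure (L ∖ {a})`
  have hfar : ∀ x ∈ L \ {a}, (|M| + 1)⁻¹ ≤ ‖x - a‖ := by
    intro x hx
    have h1 := hM ⟨x, hx, rfl⟩
    rw [mem_closedBall, dist_zero_right, norm_inv] at h1
    have hxa : 0 < ‖x - a‖ := norm_pos_iff.2 (sub_ne_zero.2 hx.2)
    rw [inv_le_comm₀ (by positivity) hxa]
    linarith [le_abs_self M]
  have hcl := endpoint_mem_closure_diff e
  rw [Metric.mem_closure_iff] at hcl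
  obtain ⟨x, hx, hdist⟩ := hcl _ (inv_pos.2 (by positivity : (0 : ℝ) < |M| + 1))
  rw [dist_comm, dist_eq_norm] at hdist
  exact (not_lt.2 (hfar x hx)) hdist

/-- `arcInv` of a Jordan arc about its initial point is connected. [folklore] -/
theorem isConnected_arcInv : IsConnected (arcInv L ((e 0 : L) : ℂ)) := by
  set a : ℂ := ((e 0 : L) : ℂ) with ha
  have haL : a ∈ L := (e 0).2
  have hLc : IsCompact L := isCompact_arc e
  -- `T(ℂ ∖ L)` is connected and accumulates at `0`
  have hΩ : IsConnected Lᶜ := JordanArcSeparation_holds L ⟨e⟩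
  set S : Set ℂ := (fun w ↦ (w - a)⁻¹) '' Lᶜ with hS
  have hSc : IsConnected S := hΩ.image _ fun w hw ↦
    ((by fun_prop : ContinuousAt (fun w : ℂ ↦ w - a) w).inv₀
      (sub_ne_zero.2 fun h ↦ hw (h ▸ haL))).continuousWithinAt
  have hSsub : S ⊆ arcInv L a := by
    rintro _ ⟨w, hw, rfl⟩
    exact inv_sub_mem_arcInv haL hw
  have h0 : (0 : ℂ) ∈ closure S := by
    rw [Metric.mem_closure_iff]
    intro ε hε
    obtain ⟨R, hR0, hR⟩ := hLc.isBounded.subset_closedBall_lt 0 a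
    -- a far point `w = a + (R + ε⁻¹ + 1)` is off `L` and inverts into `B(0, ε)`
    set w : ℂ := a + ((R + ε⁻¹ + 1 : ℝ) : ℂ) with hw
    have hwa : ‖w - a‖ = R + ε⁻¹ + 1 := by
      rw [hw, add_sub_cancel_left, Complex.norm_real, Real.norm_eq_abs, abs_of_pos (by positivity)]
    have hwL : w ∉ L := fun h ↦ by
      have := hR h
      rw [mem_closedBall, dist_eq_norm, hwa] at this
      linarith [inv_pos.2 hε]
    refine ⟨(w - a)⁻¹, ⟨w, hwL, rfl⟩, ?_⟩
    rw [dist_comm, dist_zero_right, norm_inv, hwa, inv_lt_comm₀ (by positivity) hε]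
    linarith
  have hsub : arcInv L a ⊆ closure S := by
    intro ζ hζ
    rcases eq_or_ne ζ 0 with rfl | hζ0
    · exact h0
    · refine subset_closure ⟨a + ζ⁻¹, (mem_arcInv_of_ne_zero hζ0).1 hζ, ?_⟩
      simp
  exact ⟨⟨0, zero_mem_arcInv⟩, hSc.isPreconnected.subset_closure hSsub hsub⟩

/-- `arcInv` is a proper subset of `ℂ` (the final point of the arc inverts into its complement). [folklore] -/
theorem arcInv_ne_univ : arcInv L ((e 0 : L) : ℂ) ≠ univ := by
  intro h
  have : ((((e 1 : L) : ℂ) - ((e 0 : L) : ℂ))⁻¹) ∈ (arcInv L ((e 0 : L) : ℂ))ᶜ := by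
    rw [compl_arcInv_eq]
    exact ⟨_, endpoint_one_mem_diff e, rfl⟩
  rw [h, compl_univ] at this
  exact this

/-- **`arcInv` carries holomorphic square roots** (its complement is connected and unbounded,
so hole-free; `Complex.hasSqrt_of_compl`). [folklore] -/
theorem hasSqrt_arcInv : Complex.HasSqrt (arcInv L ((e 0 : L) : ℂ)) := by
  refine Complex.hasSqrt_of_compl (isOpen_arcInv (isCompact_arc e))
    (isConnected_arcInv e).isPreconnected fun y hy hb ↦ not_isBounded_compl_arcInv e ?_
  exact hb.subset ((isConnected_compl_arcInv e).isPreconnected.subset_connectedComponentIn hy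
    Subset.rfl)

/-- **The Riemann map of the inverted complement**: a holomorphic bijection
`φ : arcInv L a → 𝔻` with `φ(0) = 0`, zero-free derivative and holomorphic inverse
`invFunOn φ (arcInv L a)` (`Complex.exists_bijOn_ball_of_hasSqrt`). [folklore] -/
theorem exists_arcRiemannMap :
    ∃ φ : ℂ → ℂ, DifferentiableOn ℂ φ (arcInv L ((e 0 : L) : ℂ)) ∧
      BijOn φ (arcInv L ((e 0 : L) : ℂ)) (ball 0 1) ∧ φ 0 = 0 ∧
      (∀ z ∈ arcInv L ((e 0 : L) : ℂ), deriv φ z ≠ 0) ∧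
      DifferentiableOn ℂ (invFunOn φ (arcInv L ((e 0 : L) : ℂ))) (ball 0 1) :=
  Complex.exists_bijOn_ball_of_hasSqrt (isOpen_arcInv (isCompact_arc e))
    (isConnected_arcInv e).isPreconnected (hasSqrt_arcInv e) (arcInv_ne_univ e) zero_mem_arcInv

end Inversion

/-! ### The Green function of the complement of the arc -/

section Green

variable {L : Set ℂ} (e : I ≃ₜ L)

/-- A chosen Riemann map `φ` of `arcInv L (e 0)` onto the unit disc with `φ(0) = 0`. [folklore] -/
def arcRiemannMap (e : I ≃ₜ L) : ℂ → ℂ := (exists_arcRiemannMap e).choose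

/-- The defining properties of `arcRiemannMap`. [folklore] -/
theorem arcRiemannMap_spec :
    DifferentiableOn ℂ (arcRiemannMap e) (arcInv L ((e 0 : L) : ℂ)) ∧
      BijOn (arcRiemannMap e) (arcInv L ((e 0 : L) : ℂ)) (ball 0 1) ∧ arcRiemannMap e 0 = 0 ∧
      (∀ z ∈ arcInv L ((e 0 : L) : ℂ), deriv (arcRiemannMap e) z ≠ 0) ∧
      DifferentiableOn ℂ (invFunOn (arcRiemannMap e) (arcInv L ((e 0 : L) : ℂ))) (ball 0 1) :=
  (exists_arcRiemannMap e).choose_spec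

/-- The pulled-back map `Φ(w) = φ((w - a)⁻¹)` on `ℂ ∖ L`. [folklore] -/
def arcGreenMap (e : I ≃ₜ L) (w : ℂ) : ℂ := arcRiemannMap e ((w - ((e 0 : L) : ℂ))⁻¹)

open Classical in
/-- **The Green function of `ℂ ∖ L` with pole at infinity**: `-log ‖φ((w - a)⁻¹)‖` off `L`,
`0` on `L`. [folklore] -/
def arcGreen (e : I ≃ₜ L) (w : ℂ) : ℝ :=
  if w ∈ L then 0 else -Real.log ‖arcGreenMap e w‖

/-- On the arc the Green function vanishes. [folklore] -/
theorem arcGreen_of_mem {w : ℂ} (hw : w ∈ L) : arcGreen e w = 0 := by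
  simp [arcGreen, hw]

/-- Off the arc the Green function is `-log ‖Φ‖`. [folklore] -/
theorem arcGreen_of_notMem {w : ℂ} (hw : w ∉ L) : arcGreen e w = -Real.log ‖arcGreenMap e w‖ := by
  simp [arcGreen, hw]

/-- `Φ` is holomorphic on `ℂ ∖ L`. [folklore] -/
theorem differentiableOn_arcGreenMap : DifferentiableOn ℂ (arcGreenMap e) Lᶜ := by
  intro w hw
  have haL : ((e 0 : L) : ℂ) ∈ L := (e 0).2
  have hwa : w - ((e 0 : L) : ℂ) ≠ 0 := sub_ne_zero.2 fun h ↦ hw (h ▸ haL)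
  have hmem := inv_sub_mem_arcInv haL hw
  have h1 : DifferentiableAt ℂ (arcRiemannMap e) ((w - ((e 0 : L) : ℂ))⁻¹) :=
    (arcRiemannMap_spec e).1.differentiableAt
      ((isOpen_arcInv (isCompact_arc e)).mem_nhds hmem)
  exact (h1.comp w ((differentiableAt_inv hwa).comp w
    ((differentiableAt_id).sub_const _))).differentiableWithinAt

/-- `Φ` takes values in the punctured unit disc: `0 < ‖Φ w‖ < 1` off `L`. [folklore] -/
theorem norm_arcGreenMap_mem {w : ℂ} (hw : w ∉ L) : ‖arcGreenMap e w‖ ∈ Ioo (0 : ℝ) 1 := by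
  have haL : ((e 0 : L) : ℂ) ∈ L := (e 0).2
  obtain ⟨-, hbij, h0, -, -⟩ := arcRiemannMap_spec e
  have hmem := inv_sub_mem_arcInv haL hw
  have hwa : w - ((e 0 : L) : ℂ) ≠ 0 := sub_ne_zero.2 fun h ↦ hw (h ▸ haL)
  refine ⟨norm_pos_iff.2 fun h ↦ ?_, mem_ball_zero_iff.1 (hbij.mapsTo hmem)⟩
  rw [arcGreenMap, ← h0] at h
  have := hbij.injOn hmem zero_mem_arcInv h
  exact inv_ne_zero hwa this

/-- **The Green function is positive off the arc.** [folklore] -/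
theorem arcGreen_pos {w : ℂ} (hw : w ∉ L) : 0 < arcGreen e w := by
  rw [arcGreen_of_notMem e hw, neg_pos]
  obtain ⟨h0, h1⟩ := norm_arcGreenMap_mem e hw
  exact Real.log_neg h0 h1

/-- The Green function is nonnegative. [folklore] -/
theorem arcGreen_nonneg (w : ℂ) : 0 ≤ arcGreen e w := by
  by_cases hw : w ∈ L
  · rw [arcGreen_of_mem e hw]
  · exact (arcGreen_pos e hw).le

/-- **Boundary behaviour of the Riemann map**: the set where `‖φ‖ ≤ t < 1` is compact — it is
the image of the closed disc `B̄(0, t)` under the continuous inverse `φ⁻¹`. Hence `‖φ‖ → 1`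
at the boundary of `arcInv` and at infinity. [folklore] -/
theorem isCompact_setOf_norm_arcRiemannMap_le {t : ℝ} (ht : t < 1) :
    IsCompact {ζ : ℂ | ζ ∈ arcInv L ((e 0 : L) : ℂ) ∧ ‖arcRiemannMap e ζ‖ ≤ t} := by
  obtain ⟨-, hbij, -, -, hinvd⟩ := arcRiemannMap_spec e
  set Ω := arcInv L ((e 0 : L) : ℂ) with hΩ
  set ψ := invFunOn (arcRiemannMap e) Ω with hψ
  have hψc : ContinuousOn ψ (closedBall 0 t) :=
    hinvd.continuousOn.mono (closedBall_subset_ball ht)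
  have heq : {ζ : ℂ | ζ ∈ Ω ∧ ‖arcRiemannMap e ζ‖ ≤ t} = ψ '' closedBall 0 t := by
    ext ζ
    constructor
    · rintro ⟨hζ, hle⟩
      refine ⟨arcRiemannMap e ζ, by rwa [mem_closedBall, dist_zero_right], ?_⟩
      exact hbij.invOn_invFunOn.1 hζ
    · rintro ⟨η, hη, rfl⟩
      have hηb : η ∈ ball (0 : ℂ) 1 := closedBall_subset_ball ht hη
      refine ⟨hbij.surjOn.mapsTo_invFunOn hηb, ?_⟩
      rw [hbij.invOn_invFunOn.2 hηb]
      rwa [mem_closedBall, dist_zero_right] at hη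
  rw [heq]
  exact (isCompact_closedBall 0 t).image_of_continuousOn hψc

/-- **The Green function is continuous on `ℂ`** (and vanishes on `L`): off `L` it is the
continuous `-log ‖Φ‖`; at a point of `L` it tends to `0`, because `{‖φ‖ ≤ e^{-ε}}` is a compact
subset of `arcInv` which the inversion of nearby points avoids. [folklore] -/
theorem continuous_arcGreen : Continuous (arcGreen e) := by
  set a : ℂ := ((e 0 : L) : ℂ) with ha
  have haL : a ∈ L := (e 0).2
  have hLc : IsCompact L := isCompact_arc e
  rw [continuous_iff_continuousAt]
  intro w₀
  by_cases hw₀ : w₀ ∈ L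
  · -- at a point of the arc: `arcGreen → 0`
    rw [ContinuousAt, arcGreen_of_mem e hw₀, Metric.tendsto_nhds]
    intro ε hε
    set K : Set ℂ := {ζ : ℂ | ζ ∈ arcInv L a ∧ ‖arcRiemannMap e ζ‖ ≤ Real.exp (-ε)} with hK
    have hKc : IsCompact K := isCompact_setOf_norm_arcRiemannMap_le e (Real.exp_lt_one_iff.2 (by linarith))
    -- it suffices that nearby points `w ∉ L` invert outside `K`
    have key : ∀ᶠ w in 𝓝 w₀, w ∉ L → (w - a)⁻¹ ∉ K := by
      by_cases hwa : w₀ = a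
      · -- near the pole of the inversion: `K` is bounded
        obtain ⟨M, hM0, hM⟩ := hKc.isBounded.subset_ball_lt 0 0
        have hnhds : ball a M⁻¹ ∈ 𝓝 w₀ := by rw [hwa]; exact ball_mem_nhds a (inv_pos.2 hM0)
        filter_upwards [hnhds] with w hw hwL hwK
        have hwa' : w - a ≠ 0 := sub_ne_zero.2 fun h ↦ hwL (h ▸ haL)
        have h1 := hM hwK
        rw [mem_ball, dist_zero_right, norm_inv] at h1
        rw [mem_ball, dist_eq_norm] at hw
        have : M < ‖w - a‖⁻¹ := by
          rwa [lt_inv_comm₀ hM0 (norm_pos_iff.2 hwa')]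
        linarith
      · -- `T w₀ ∉ arcInv ⊇ K`, `K` closed, `T` continuous at `w₀`
        have hT0 : (w₀ - a)⁻¹ ∉ K := fun h ↦ by
          have h1 : (w₀ - a)⁻¹ ∈ arcInv L a := h.1
          rw [mem_arcInv_of_ne_zero (inv_ne_zero (sub_ne_zero.2 hwa)), inv_inv, add_sub_cancel] at h1
          exact h1 hw₀
        have hcont : ContinuousAt (fun w : ℂ ↦ (w - a)⁻¹) w₀ :=
          (by fun_prop : ContinuousAt (fun w : ℂ ↦ w - a) w₀).inv₀ (sub_ne_zero.2 hwa)
        filter_upwards [hcont.preimage_mem_nhds (hKc.isClosed.isOpen_compl.mem_nhds hT0)] with w hw _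
        exact hw
    filter_upwards [key] with w hw
    rw [dist_zero_right, Real.norm_eq_abs, abs_lt]
    by_cases hwL : w ∈ L
    · rw [arcGreen_of_mem e hwL]
      exact ⟨by linarith, hε⟩
    · refine ⟨by linarith [arcGreen_pos e hwL], ?_⟩
      have hnotK := hw hwL
      have hmem : (w - a)⁻¹ ∈ arcInv L a := inv_sub_mem_arcInv haL hwL
      have hgt : Real.exp (-ε) < ‖arcGreenMap e w‖ := by
        by_contra hle
        exact hnotK ⟨hmem, not_lt.1 hle⟩
      rw [arcGreen_of_notMem e hwL, neg_lt]
      calc -ε = Real.log (Real.exp (-ε)) := (Real.log_exp _).symm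
        _ < Real.log ‖arcGreenMap e w‖ := Real.log_lt_log (Real.exp_pos _) hgt
  · -- off the arc: `-log ‖Φ‖` is continuous
    have hopen : IsOpen Lᶜ := hLc.isClosed.isOpen_compl
    have hcont : ContinuousAt (fun w ↦ -Real.log ‖arcGreenMap e w‖) w₀ := by
      have h1 : ContinuousAt (arcGreenMap e) w₀ :=
        (differentiableOn_arcGreenMap e).continuousOn.continuousAt (hopen.mem_nhds hw₀)
      exact ((h1.norm).log (norm_arcGreenMap_mem e hw₀).1.ne').neg
    refine hcont.congr ?_
    filter_upwards [hopen.mem_nhds hw₀] with w hw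
    exact (arcGreen_of_notMem e hw).symm

end Green

end Literature.Analysis.Complex
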